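import Summits.CriticalPhenomena.PercolationContinuityZ3.Theorems.Transplant.FKConnectivityAllQAntipodalGluing
import Summits.CriticalPhenomena.PercolationContinuityZ3.Theorems.Transplant.FKConnectivityAllQSPMono
import Summits.CriticalPhenomena.PercolationContinuityZ3.Theorems.Transplant.FKConnectivityAllQSPReroot
import HarnessLib

/-!
# Connectivity correlation inequalities for `φ_{w,q}`, every `q > 0` — file 21: ANTIPODAL UP-CORRELATION on two-terminal
# series–parallel networks (every `q > 0`)

Support file (`--supports stmt-CriticalPhenomena-4575`), FK sub-lane `prim-bschramm-fk-2` (gen 11) of the post-continuity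
programme; builds on p205010 (kernel theorem, internal audit signed; external expert review pending).  No definitions, no named
facts, no sorries; standard axioms.

THE OBJECT (`…AntipodalDefs.lean`).  For an edge set `M`, terminals `s, t`, `q ∈ ℝ` and a test function `h` on configurations,
`apUpc q M s t h = ∑_{γ ⊆ M} q^{k(γ)+k(M\γ)} · (1{s↔t in γ} - 1{s↔t in M\γ}) · h(γ)`, which by the involution `γ ↦ M \ γ` equals
`∑_{γ : s↔t in γ, s↮t in M\γ} q^{k(γ)+k(M\γ)} (h(γ) - h(M\γ))`: the correlation, under the ANTIPODAL law `w(γ) ∝ q^{k(γ)+k(M\γ)}` of a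
configuration `γ` — the law of `ω` for two INDEPENDENT random-cluster samples `(ω, ω')` of `φ_{M,p,q}` conditioned on `ω' = M \ ω`, the
same for every `p ∈ (0,1)^M` — between `h` and the odd type function "`γ` joins the terminals but its complement does not" minus "the
complement does but `γ` does not".

THE THEOREM (`FK.apUpc_nonneg_of_isTTSP`, `FK.apUpc_nonneg`).  If `E` is a two-terminal series–parallel network between `s` and `t`
(`FK.IsTTSP`), then for every sub-network `M ⊆ E`, EVERY `q > 0` and every `h` monotone on the subsets of `M`: `0 ≤ apUpc q M s t h`.
In words: among complementary pairs of configurations exactly one of which joins the terminals, the joining member is stochastically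
larger.  PROOF — structural induction, the same skeleton as gen 8's `FK.upcNet_of_isTTSP` but weight-free: under a parallel (resp.
series) gluing the antipodal exponent splits as `k(γ)+k(γᶜ)+2|V| = Σ_i (k(γ_i)+k(γ_iᶜ)) + 1{both parts join s,t in γ} + 1{both in γᶜ}`
(resp. without the indicator terms; `FK.clusterCount_parallel` / `FK.clusterCount_series` applied to `γ` AND to its complement), the
terminal type is `(c₁ ∨ c₂, c̄₁ ∨ c̄₂)` (resp. `(c₁c₂, c̄₁c̄₂)`), and the POINTWISE identities
`q^{c₁c₂ + c̄₁c̄₂}((c₁∨c₂) - (c̄₁∨c̄₂)) = α(c₂,c̄₂)(c₁ - c̄₁) + β(c₁,c̄₁)(c₂ - c̄₂)`, `α = (1-c₂)(1-c̄₂) + q(1-c₂)c̄₂`, `β = (1-c₁)(1-c̄₁) + q c₁(1-c̄₁)`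
(`FK.ap_summand_parallel`) and `c₁c₂ - c̄₁c̄₂ = c̄₂(c₁ - c̄₁) + c₁(c₂ - c̄₂)` (`FK.ap_summand_series`) express `q^{2|V|}·apUpc(M₁ ⊔ M₂; h)` as a
combination with NONNEGATIVE coefficients of the parts' functionals applied to the SECTIONS `h(· ∪ γ₂)`, `h(γ₁ ∪ ·)`
(`FK.apUpc_parallel_eq`, `FK.apUpc_series_eq`); a single edge gives `q^{k(∅)+k({st})}(h({st}) - h(∅)) ≥ 0`.  No sign of `q - 1` enters:
the statement is uniform in `q > 0`.

WHY (`…AntipodalNegDep.lean`).  For `x = st ∉ E` and `g` not reading `x`, `q · apPsi q (E ∪ {x}) 1_x g = 2(q-1) · apUpc q E s t g`; so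
for `0 < q < 1` the theorem says that the square-free coefficients (one for each sub-network `M`) of the polynomial
`Z²(z)·Cov_{φ_{z,q}}(ω_x, g)` in the edge odds `z` are `≤ 0` on every series–parallel graph presented from the edge `x` — the
COEFFICIENTWISE form of single-edge negative dependence (`FK.edgeNegDep_of_isTTSP`, gen 8, is the value at `z ≥ 0`), which FAILS for `K₄`
(opposite edges, `q < (√17-3)/2`: the coefficient of `∏_{e ≠ x,y} z_e · z_x z_y` in `Z² Cov(ω_x, ω_y)` is `q²(1-q)(2-3q-q²) > 0`); for `q > 1`
the same coefficients are `≥ 0`.  Not in print as far as searched (Rayleigh / Potts–Rayleigh conditions are pairwise and value-level: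
Wagner 2008 §5, Semple–Welsh 2008; Park 2026 Lemma 6.3 is the value-level `μ¹ ≽ μ⁰` on TTSP networks).
[cite: Grimmett2006, §1.4 eq. (1.20) (p. 15); §3.8 Thm. (3.90) (pp. 61–62); §3.9 (pp. 63–64)] [cite: Wagner2006, Thm. 5.8(d), §5.3]
-/

noncomputable section

namespace Summit.CriticalPhenomena.PercolationContinuityZ3.Theorems

namespace FK

open SimpleGraph Literature.Probability.LatticeModels Literature.Probability.Percolation
open scoped Classical

variable {V : Type*} [Fintype V]

/-! ### The single edge, and the theorem -/

section Main

variable {s t : V}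

omit [Fintype V] in
/-- The functional of the empty network vanishes. [folklore] -/
theorem apUpc_empty (q : ℝ) (s t : V) (h : Finset (Sym2 V) → ℝ) : apUpc q ∅ s t h = 0 := by
  unfold apUpc
  rw [Finset.powerset_empty, Finset.sum_singleton, sdiff_self, Finset.bot_eq_empty, sub_self, zero_mul, mul_zero]

omit [Fintype V] in
/-- **The single edge**: `apUpc({st}; h) = q^{k(∅)+k({st})} (h({st}) - h(∅)) ≥ 0` for `h(∅) ≤ h({st})` (`q > 0`). [folklore] -/
theorem apUpc_edge {q : ℝ} (hq : 0 < q) (hst : s ≠ t) {h : Finset (Sym2 V) → ℝ} (hmono : h ∅ ≤ h {s(s, t)}) :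
    0 ≤ apUpc q {s(s, t)} s t h := by
  unfold apUpc
  rw [← Finset.insert_empty, Finset.sum_powerset_insert (Finset.notMem_empty _), Finset.powerset_empty,
    Finset.sum_singleton, Finset.sum_singleton, Finset.insert_empty, Finset.sdiff_empty, sdiff_self, Finset.bot_eq_empty]
  have c0 : apConn (∅ : Finset (Sym2 V)) s t = 0 := by
    refine apConn_of_not_reachable fun hr => ?_
    have h0 : openGraph (↑(∅ : Finset (Sym2 V)) : BondConfig V) = ⊥ := by
      rw [Finset.coe_empty, openGraph, fromEdgeSet_empty]
    rw [h0, reachable_bot] at hr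
    exact hst hr
  have c1 : apConn ({s(s, t)} : Finset (Sym2 V)) s t = 1 := by
    refine apConn_of_reachable (Adj.reachable ((fromEdgeSet_adj _).2 ⟨?_, hst⟩))
    rw [Finset.coe_singleton]; rfl
  have ex : apExp ({s(s, t)} : Finset (Sym2 V)) ∅ = apExp {s(s, t)} {s(s, t)} := by
    unfold apExp
    rw [Finset.sdiff_empty, sdiff_self, Finset.bot_eq_empty, add_comm]
  rw [c0, c1, ex]
  have hp : 0 < q ^ apExp ({s(s, t)} : Finset (Sym2 V)) {s(s, t)} := pow_pos hq _
  nlinarith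

/-- **THEOREM (antipodal up-correlation on two-terminal series–parallel networks, every `q > 0`).**  If `E` is a two-terminal
series–parallel network between `s` and `t` (`FK.IsTTSP E s t`), then for every sub-network `M ⊆ E`, every `q > 0` and every test
function `h` that is monotone on the subsets of `M`,
`0 ≤ apUpc q M s t h = ∑_{γ ⊆ M : s↔t in γ, s↮t in M\γ} q^{k(γ)+k(M\γ)} (h(γ) - h(M \ γ))`:
among COMPLEMENTARY PAIRS of configurations of `M` exactly one of which joins the terminals, weighted by `q^{#clusters}` of both
members — equivalently, for two independent samples `ω, ω'` of the random-cluster measure `φ_{M,p,q}` (any `p ∈ (0,1)^M`) conditioned on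
`ω' = M \ ω` — the joining member is stochastically LARGER on increasing functions.  Proof: induction over the series/parallel structure;
both compositions turn the functional into nonnegative combinations of the parts' functionals applied to sections of `h`
(`apUpc_series_eq`, `apUpc_parallel_eq`); a single edge gives `q^{a}(h({st}) - h(∅)) ≥ 0`.  For `q ≥ 1` the law of the pair
`(ω, ω' = ωᶜ)` is that of an FKG measure and its negative... (no: the statement is `q`-uniform and is NOT an FKG consequence; it is
the square-free-coefficient form of single-edge negative dependence for `q < 1`, see `…AntipodalNegDep.lean`).
[cite: Grimmett2006, §3.8 Thm. (3.90) (pp. 61–62); §3.9 (pp. 63–64)] [cite: Wagner2006, Thm. 5.8(d), §5.3] -/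
theorem apUpc_nonneg_of_isTTSP {q : ℝ} (hq : 0 < q) {E : Finset (Sym2 V)} {s t : V} (hE : IsTTSP E s t) :
    ∀ M : Finset (Sym2 V), M ⊆ E → ∀ h : Finset (Sym2 V) → ℝ,
      (∀ ⦃A B : Finset (Sym2 V)⦄, A ⊆ B → B ⊆ M → h A ≤ h B) → 0 ≤ apUpc q M s t h := by
  induction hE with
  | @edge s t hst =>
    intro M hM h hmono
    rcases Finset.subset_singleton_iff.1 hM with rfl | rfl
    · rw [apUpc_empty]
    · exact apUpc_edge hq hst (hmono (Finset.empty_subset _) le_rfl)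
  | @series E₁ E₂ a m b h₁ h₂ hd hV ha hb ih₁ ih₂ =>
    intro M hM h hmono
    have g₁ : ∀ e ∈ (↑E₁ : Set (Sym2 V)), ∀ z ∈ e, z ∈ {z : V | ∃ e ∈ E₁, z ∈ e} := fun e he z hz => ⟨e, he, hz⟩
    have g₂ : ∀ e ∈ (↑E₂ : Set (Sym2 V)), ∀ z ∈ e, z ∈ {z : V | ∃ e ∈ E₂, z ∈ e} := fun e he z hz => ⟨e, he, hz⟩
    have gS : {z : V | ∃ e ∈ E₁, z ∈ e} ∩ {z : V | ∃ e ∈ E₂, z ∈ e} ⊆ ({m} : Set V) :=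
      fun z hz => hV z hz.1 hz.2
    have gaV₂ : a ∉ {z : V | ∃ e ∈ E₂, z ∈ e} := fun ⟨e, he, hae⟩ => ha e he hae
    have gbV₁ : b ∉ {z : V | ∃ e ∈ E₁, z ∈ e} := fun ⟨e, he, hbe⟩ => hb e he hbe
    have gam : a ≠ m := by
      obtain ⟨e, he, hme⟩ := h₂.left_mem
      intro ham; exact ha e he (ham ▸ hme)
    have gbm : b ≠ m := by
      obtain ⟨e, he, hme⟩ := h₁.right_mem
      intro hbm; exact hb e he (hbm ▸ hme)
    have gab : a ≠ b := by
      obtain ⟨e, he, hae⟩ := h₁.left_mem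
      intro hab; exact hb e he (hab ▸ hae)
    have hMeq : M = M ∩ E₁ ∪ M ∩ E₂ := by
      rw [← Finset.inter_union_distrib_left, Finset.inter_eq_left.2 hM]
    rw [hMeq] at hmono ⊢
    exact apUpc_series_nonneg hq hd g₁ g₂ gS gaV₂ gbV₁ gam gbm gab Finset.inter_subset_right Finset.inter_subset_right
      (ih₁ _ Finset.inter_subset_right) (ih₂ _ Finset.inter_subset_right) hmono
  | @parallel E₁ E₂ s t h₁ h₂ hd hV ih₁ ih₂ =>
    intro M hM h hmono
    have g₁ : ∀ e ∈ (↑E₁ : Set (Sym2 V)), ∀ z ∈ e, z ∈ {z : V | ∃ e ∈ E₁, z ∈ e} := fun e he z hz => ⟨e, he, hz⟩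
    have g₂ : ∀ e ∈ (↑E₂ : Set (Sym2 V)), ∀ z ∈ e, z ∈ {z : V | ∃ e ∈ E₂, z ∈ e} := fun e he z hz => ⟨e, he, hz⟩
    have gS : {z : V | ∃ e ∈ E₁, z ∈ e} ∩ {z : V | ∃ e ∈ E₂, z ∈ e} ⊆ ({s, t} : Set V) := by
      intro z hz
      rcases hV z hz.1 hz.2 with h | h
      · exact Or.inl h
      · exact Or.inr h
    have gst : s ≠ t := h₁.ne
    have hMeq : M = M ∩ E₁ ∪ M ∩ E₂ := by
      rw [← Finset.inter_union_distrib_left, Finset.inter_eq_left.2 hM]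
    rw [hMeq] at hmono ⊢
    exact apUpc_parallel_nonneg hq hd g₁ g₂ gS gst Finset.inter_subset_right Finset.inter_subset_right
      (ih₁ _ Finset.inter_subset_right) (ih₂ _ Finset.inter_subset_right) hmono

/-- **Antipodal up-correlation, the whole network.** [cite: Grimmett2006, §3.8 (pp. 61–62)] [cite: Wagner2006, Thm. 5.8(d), §5.3] -/
theorem apUpc_nonneg {q : ℝ} (hq : 0 < q) {E : Finset (Sym2 V)} {s t : V} (hE : IsTTSP E s t)
    {h : Finset (Sym2 V) → ℝ} (hmono : ∀ ⦃A B : Finset (Sym2 V)⦄, A ⊆ B → B ⊆ E → h A ≤ h B) :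
    0 ≤ apUpc q E s t h :=
  apUpc_nonneg_of_isTTSP hq hE E le_rfl h hmono

end Main

/-! ### From up-correlation to the antipodal covariance form: single-edge (and two-edge) negative dependence, square-free coefficients -/

section NegDep

variable {s t : V}

omit [Fintype V] in
/-- The antipodal exponent is symmetric under `γ ↦ E \ γ`. [folklore] -/
theorem apExp_compl {E γ : Finset (Sym2 V)} (h : γ ⊆ E) : apExp E (E \ γ) = apExp E γ := by
  unfold apExp
  rw [Finset.sdiff_sdiff_eq_self h, add_comm]

omit [Fintype V] in
/-- Re-indexing a sum over configurations by the involution `γ ↦ E \ γ`. [folklore] -/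
theorem sum_powerset_flip {β : Type*} [AddCommMonoid β] (E : Finset (Sym2 V)) (φ : Finset (Sym2 V) → β) :
    ∑ γ ∈ E.powerset, φ γ = ∑ γ ∈ E.powerset, φ (E \ γ) := by
  refine Finset.sum_nbij' (fun γ => E \ γ) (fun γ => E \ γ) (fun γ _ => Finset.mem_powerset.2 Finset.sdiff_subset)
    (fun γ _ => Finset.mem_powerset.2 Finset.sdiff_subset) (fun γ hγ => ?_) (fun γ hγ => ?_) (fun γ hγ => ?_)
  · exact Finset.sdiff_sdiff_eq_self (Finset.mem_powerset.1 hγ)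
  · exact Finset.sdiff_sdiff_eq_self (Finset.mem_powerset.1 hγ)
  · simp only [Finset.sdiff_sdiff_eq_self (Finset.mem_powerset.1 hγ)]

omit [Fintype V] in
/-- The flipped functional: `∑_γ q^{k+k̄} (c(γ) - c(γᶜ)) h(γᶜ) = - apUpc q E s t h`. [folklore] -/
theorem sum_apSign_compl (q : ℝ) (E : Finset (Sym2 V)) (s t : V) (h : Finset (Sym2 V) → ℝ) :
    ∑ γ ∈ E.powerset, q ^ apExp E γ * ((apConn γ s t - apConn (E \ γ) s t) * h (E \ γ)) = - apUpc q E s t h := by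
  unfold apUpc
  rw [sum_powerset_flip E (fun γ => q ^ apExp E γ * ((apConn γ s t - apConn (E \ γ) s t) * h (E \ γ))),
    ← Finset.sum_neg_distrib]
  refine Finset.sum_congr rfl fun γ hγ => ?_
  have hγE := Finset.mem_powerset.1 hγ
  simp only [Finset.sdiff_sdiff_eq_self hγE, apExp_compl hγE]
  ring

/-- **The one-edge antipodal covariance form is the up-correlation functional**: for `x = st ∉ E` and a test function `g` that does
not read `x`, `q · apPsi q (E ∪ {x}) 1_x g = 2(q - 1) · apUpc q E s t g`.  (Opening `x` on the side of `γ` turns `k(γ ∪ x) + 1` into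
`k(γ) + c(γ)`, `FK.clusterCount_union_pair_add`; the two members of each complementary pair of `E ∪ {x}` contribute
`q^{k(γ)+k(γᶜ)}(q^{c(γ)} - q^{c(γᶜ)})(g(γ) - g(γᶜ))/q`.) [cite: Grimmett2006, §1.4 eq. (1.20) (p. 15); Thm. (3.1)(a)] -/
theorem apPsi_edge_eq (q : ℝ) {E : Finset (Sym2 V)} (hst : s(s, t) ∉ E) {g : Finset (Sym2 V) → ℝ}
    (hg : ∀ A : Finset (Sym2 V), g (insert s(s, t) A) = g A) :
    q * apPsi q (insert s(s, t) E) (fun A => if s(s, t) ∈ A then 1 else 0) g = 2 * (q - 1) * apUpc q E s t g := by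
  -- split the configurations of `E ∪ {x}` by the state of `x`
  unfold apPsi
  rw [Finset.sum_powerset_insert hst, ← Finset.sum_add_distrib, Finset.mul_sum]
  -- the target, written as one sum over `γ ⊆ E`
  have hR : 2 * (q - 1) * apUpc q E s t g =
      ∑ γ ∈ E.powerset, (q - 1) * (q ^ apExp E γ * ((apConn γ s t - apConn (E \ γ) s t) * (g γ - g (E \ γ)))) := by
    have h1 : ∑ γ ∈ E.powerset, (q - 1) * (q ^ apExp E γ * ((apConn γ s t - apConn (E \ γ) s t) * (g γ - g (E \ γ)))) =
        (q - 1) * apUpc q E s t g -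
          (q - 1) * ∑ γ ∈ E.powerset, q ^ apExp E γ * ((apConn γ s t - apConn (E \ γ) s t) * g (E \ γ)) := by
      unfold apUpc
      rw [Finset.mul_sum, Finset.mul_sum, ← Finset.sum_sub_distrib]
      exact Finset.sum_congr rfl fun γ _ => by ring
    rw [h1, sum_apSign_compl]
    ring
  rw [hR]
  refine Finset.sum_congr rfl fun γ hγ => ?_
  have hγE : γ ⊆ E := Finset.mem_powerset.1 hγ
  have hxγ : s(s, t) ∉ γ := fun h => hst (hγE h)
  have hxc : s(s, t) ∉ E \ γ := fun h => hst (Finset.sdiff_subset h)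
  -- the complements inside `E ∪ {x}`
  have e1 : insert s(s, t) E \ γ = insert s(s, t) (E \ γ) := Finset.insert_sdiff_of_notMem E hxγ
  have e2 : insert s(s, t) E \ insert s(s, t) γ = E \ γ := by
    rw [Finset.insert_sdiff_insert, Finset.sdiff_insert_of_notMem hst]
  rw [e1, e2]
  simp only [hxγ, hxc, Finset.mem_insert_self, if_true, if_false, hg]
  -- cluster counts with `x` opened on one side
  have k1 := clusterCount_union_pair_add (↑γ : BondConfig V) s t
  have k2 := clusterCount_union_pair_add (↑(E \ γ) : BondConfig V) s t
  have c1 : (↑(insert s(s, t) γ) : BondConfig V) = ↑γ ∪ {s(s, t)} := by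
    rw [Finset.coe_insert, Set.insert_eq, Set.union_comm]
  have c2 : (↑(insert s(s, t) (E \ γ)) : BondConfig V) = ↑(E \ γ) ∪ {s(s, t)} := by
    rw [Finset.coe_insert, Set.insert_eq, Set.union_comm]
  have ex1 : apExp (insert s(s, t) E) (insert s(s, t) γ) + 1 =
      apExp E γ + (if (openGraph (↑γ : BondConfig V)).Reachable s t then 1 else 0) := by
    unfold apExp
    rw [e2, c1]
    split_ifs at k1 with hr
    · rw [if_pos hr]; omega
    · rw [if_neg hr]; omega
  have ex2 : apExp (insert s(s, t) E) γ + 1 =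
      apExp E γ + (if (openGraph (↑(E \ γ) : BondConfig V)).Reachable s t then 1 else 0) := by
    unfold apExp
    rw [e1, c2]
    split_ifs at k2 with hr
    · rw [if_pos hr]; omega
    · rw [if_neg hr]; omega
  -- `q · q^{a} = q^{a+1}`
  have hq1 : q * q ^ apExp (insert s(s, t) E) (insert s(s, t) γ) =
      q ^ apExp E γ * q ^ (if (openGraph (↑γ : BondConfig V)).Reachable s t then 1 else 0) := by
    rw [← pow_succ', ex1, pow_add]
  have hq2 : q * q ^ apExp (insert s(s, t) E) γ =
      q ^ apExp E γ * q ^ (if (openGraph (↑(E \ γ) : BondConfig V)).Reachable s t then 1 else 0) := by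
    rw [← pow_succ', ex2, pow_add]
  unfold apConn
  calc q * (q ^ apExp (insert s(s, t) E) γ * ((0 - 1) * (g γ - g (E \ γ))) +
          q ^ apExp (insert s(s, t) E) (insert s(s, t) γ) * ((1 - 0) * (g γ - g (E \ γ))))
      = (q * q ^ apExp (insert s(s, t) E) (insert s(s, t) γ) - q * q ^ apExp (insert s(s, t) E) γ) * (g γ - g (E \ γ)) := by
        ring
    _ = _ := by
      rw [hq1, hq2]
      by_cases a₁ : (openGraph (↑γ : BondConfig V)).Reachable s t <;>
      by_cases b₁ : (openGraph (↑(E \ γ) : BondConfig V)).Reachable s t <;>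
      simp only [a₁, b₁, if_true, if_false, pow_one, pow_zero] <;> ring

/-- **Single-edge antipodal negative dependence on series–parallel graphs (`0 < q ≤ 1`)**: if `M` is a sub-network of a
two-terminal series–parallel network `E` between `s` and `t` and `x = st ∉ M`, then for every `g` monotone on the subsets of `M` and not
reading `x`, `apPsi q (M ∪ {x}) 1_x g = ∑_{γ ⊆ M∪{x}} q^{k(γ)+k(γᶜ)} (1_x(γ) - 1_x(γᶜ))(g(γ) - g(γᶜ)) ≤ 0` — twice the coefficient of the
square-free monomial `∏_{e ∈ M ∪ {x}} z_e` in `Z² · Cov_{φ_{z,q}}(ω_x, g)`; the value-level statement is `FK.edgeNegDep_of_isTTSP`.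
[cite: Grimmett2006, §3.9 (pp. 63–64)] [cite: Wagner2006, Thm. 5.8(d), §5.3] -/
theorem apPsi_edge_nonpos_of_isTTSP {q : ℝ} (hq0 : 0 < q) (hq1 : q ≤ 1) {E M : Finset (Sym2 V)} (hE : IsTTSP E s t)
    (hM : M ⊆ E) (hst : s(s, t) ∉ M) {g : Finset (Sym2 V) → ℝ} (hg : ∀ A : Finset (Sym2 V), g (insert s(s, t) A) = g A)
    (hmono : ∀ ⦃A B : Finset (Sym2 V)⦄, A ⊆ B → B ⊆ M → g A ≤ g B) :
    apPsi q (insert s(s, t) M) (fun A => if s(s, t) ∈ A then 1 else 0) g ≤ 0 := by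
  have key := apPsi_edge_eq q hst hg
  have hU := apUpc_nonneg_of_isTTSP hq0 hE M hM g hmono
  have h2 : q * apPsi q (insert s(s, t) M) (fun A => if s(s, t) ∈ A then 1 else 0) g ≤ 0 := by
    rw [key]; nlinarith
  nlinarith

/-- **… and its reversal for `q ≥ 1`**: the same square-free coefficients are `≥ 0` (as for an FKG measure, but here coefficientwise).
[cite: Grimmett2006, Thm. (3.8); §3.9 (pp. 63–64)] -/
theorem apPsi_edge_nonneg_of_isTTSP_of_one_le {q : ℝ} (hq1 : 1 ≤ q) {E M : Finset (Sym2 V)} (hE : IsTTSP E s t)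
    (hM : M ⊆ E) (hst : s(s, t) ∉ M) {g : Finset (Sym2 V) → ℝ} (hg : ∀ A : Finset (Sym2 V), g (insert s(s, t) A) = g A)
    (hmono : ∀ ⦃A B : Finset (Sym2 V)⦄, A ⊆ B → B ⊆ M → g A ≤ g B) :
    0 ≤ apPsi q (insert s(s, t) M) (fun A => if s(s, t) ∈ A then 1 else 0) g := by
  have hq0 : 0 < q := by linarith
  have key := apPsi_edge_eq q hst hg
  have hU := apUpc_nonneg_of_isTTSP hq0 hE M hM g hmono
  have h2 : 0 ≤ q * apPsi q (insert s(s, t) M) (fun A => if s(s, t) ∈ A then 1 else 0) g := by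
    rw [key]; nlinarith
  nlinarith

omit [Fintype V] in
/-- **Two edges reduce to one**: for `x, y ∈ E` and `g` arbitrary, the antipodal covariance form of the product indicator `1_x 1_y`
(and equally of `max(1_x, 1_y)`) is the average of the one-edge forms: `apPsi(1_x 1_y, g) = ½ (apPsi(1_x, g) + apPsi(1_y, g))` — the odd
increments satisfy `1_{xy}(γ) - 1_{xy}(γᶜ) = ½[(1_x(γ) - 1_x(γᶜ)) + (1_y(γ) - 1_y(γᶜ))]` pointwise. [folklore] -/
theorem apPsi_two_edges_eq (q : ℝ) {E : Finset (Sym2 V)} {x y : Sym2 V} (hx : x ∈ E) (hy : y ∈ E) (g : Finset (Sym2 V) → ℝ) :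
    apPsi q E (fun A => if x ∈ A ∧ y ∈ A then 1 else 0) g =
      (apPsi q E (fun A => if x ∈ A then 1 else 0) g + apPsi q E (fun A => if y ∈ A then 1 else 0) g) / 2 := by
  unfold apPsi
  rw [← Finset.sum_add_distrib, Finset.sum_div]
  refine Finset.sum_congr rfl fun γ hγ => ?_
  have hxc : x ∈ E \ γ ↔ x ∉ γ := by rw [Finset.mem_sdiff]; exact ⟨fun h => h.2, fun h => ⟨hx, h⟩⟩
  have hyc : y ∈ E \ γ ↔ y ∉ γ := by rw [Finset.mem_sdiff]; exact ⟨fun h => h.2, fun h => ⟨hy, h⟩⟩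
  simp only [hxc, hyc]
  by_cases a : x ∈ γ <;> by_cases b : y ∈ γ <;>
  simp only [a, b, and_self, and_true, and_false, if_true, if_false, not_true_eq_false, not_false_eq_true] <;> ring

/-- **Two-edge antipodal negative dependence (`0 < q ≤ 1`)**: `E` TTSP between `s, t`, `x = st ∉ E`, `y = uv ∈ E`, `g` monotone on the
subsets of `E ∪ {x}` reading neither `x` nor `y` ⇒ `apPsi q (E ∪ {x}) (1_x 1_y) g ≤ 0` (the square-free top coefficient of
`Z² Cov_{φ_{z,q}}(ω_x ω_y, g)`).  The `y`-form is the one-edge form of the sub-network `(E ∪ {x}) \ {y}` of `E ∪ {x}`, two-terminal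
series–parallel between `u, v` by re-rooting (`FK.IsTTSP.reroot`). [cite: Grimmett2006, §3.9 (pp. 63–64)] [cite: Wagner2006, Thm. 5.8(d), §5.3] -/
theorem apPsi_two_edges_nonpos_of_isTTSP {q : ℝ} (hq0 : 0 < q) (hq1 : q ≤ 1) {E : Finset (Sym2 V)} (hE : IsTTSP E s t)
    (hst : s(s, t) ∉ E) {u v : V} (huv : s(u, v) ∈ E) {g : Finset (Sym2 V) → ℝ}
    (hgx : ∀ A : Finset (Sym2 V), g (insert s(s, t) A) = g A) (hgy : ∀ A : Finset (Sym2 V), g (insert s(u, v) A) = g A)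
    (hmono : ∀ ⦃A B : Finset (Sym2 V)⦄, A ⊆ B → B ⊆ insert s(s, t) E → g A ≤ g B) :
    apPsi q (insert s(s, t) E) (fun A => if s(s, t) ∈ A ∧ s(u, v) ∈ A then 1 else 0) g ≤ 0 := by
  rw [apPsi_two_edges_eq q (Finset.mem_insert_self _ _) (Finset.mem_insert_of_mem huv)]
  have hx : apPsi q (insert s(s, t) E) (fun A => if s(s, t) ∈ A then 1 else 0) g ≤ 0 :=
    apPsi_edge_nonpos_of_isTTSP hq0 hq1 hE le_rfl hst hgx fun A B hAB hB => hmono hAB (hB.trans (Finset.subset_insert _ _))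
  -- the `y`-form: re-root `E ∪ {st}` at `y = uv`
  have hR : IsTTSP (E ∪ {s(s, t)}) u v :=
    hE.reroot (IsTTSP.edge hE.ne) (Finset.disjoint_singleton_right.2 hst) (fun z _ hz => by
      obtain ⟨e, he, hze⟩ := hz
      rw [Finset.mem_singleton] at he; subst he
      exact Sym2.mem_iff.1 hze) huv
  set M := (insert s(s, t) E).erase s(u, v) with hM
  have hMsub : M ⊆ E ∪ {s(s, t)} := by
    rw [hM, Finset.union_comm, ← Finset.insert_eq]; exact Finset.erase_subset _ _
  have hyM : s(u, v) ∉ M := Finset.notMem_erase _ _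
  have hins : insert s(u, v) M = insert s(s, t) E := Finset.insert_erase (Finset.mem_insert_of_mem huv)
  have hy : apPsi q (insert s(s, t) E) (fun A => if s(u, v) ∈ A then 1 else 0) g ≤ 0 := by
    rw [← hins]
    exact apPsi_edge_nonpos_of_isTTSP hq0 hq1 hR hMsub hyM hgy fun A B hAB hB =>
      hmono hAB (hB.trans (hins ▸ Finset.subset_insert _ _))
  linarith

end NegDep

end FK

end Summit.CriticalPhenomena.PercolationContinuityZ3.Theorems

end
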